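import Mathlib

/-!
# `DivisionGap.PerMultiplesHard` (stmt-ValiantsHypothesis-5068), line `uncharged-face-walk`:
stub `stub_matchingCount` — fibre inequalities for partial-matching counts (lead c9, cycle 9)

For a host `G : Finset (Fin n × Fin n)` and row/column sets `R C : Finset (Fin n)` write
`𝓜(R, C)` for the finset of functions `f : Fin n → Fin n` mapping `C` injectively into `R` along
cells of `G` (`(f j, j) ∈ G` for `j ∈ C`) and fixing every column outside `C` (in the statement
this finset is always written out in full).  The helper lemmas are stated for an abstract family
`M R C` of finsets characterised by the membership condition `hM` (section `Fibres`), and the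
registered statement is obtained by instantiating `M` with the written-out filter.
We prove the five elementary fibre inequalities of `stub_matchingCount`:

* (a) `#{σ : Perm (Fin n) | ∀ i, (σ i, i) ∈ G} ≤ #𝓜(univ, univ)`: `σ ↦ ⇑σ` is injective and
  lands in `𝓜(univ, univ)`.
* (b) Row split. For `U ⊆ R` and `#R = #C` there is `S ⊆ C` with `#S = #U` and
  `#𝓜(R, C) ≤ C(#N(U), #U) · (#𝓜(U, S) · #𝓜(R \ U, C \ S))`, where
  `N(U) = {j ∈ C | ∃ r ∈ U, (r, j) ∈ G}`.  Every `f ∈ 𝓜(R, C)` maps `C` onto `R`, so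
  `S_f := {j ∈ C | f j ∈ U}` is a `#U`-subset of `N(U)`; cover `𝓜(R, C)` by the fibres of
  `f ↦ S_f` over `powersetCard #U N(U)` (which has `C(#N(U), #U)` members), inject the fibre over
  `S` into `𝓜(U, S) ×ˢ 𝓜(R \ U, C \ S)` by `f ↦ (f|S, f|(C \ S))`, and take `S` maximising the
  size of that product (if there is no `#U`-subset of `N(U)` at all, `𝓜(R, C) = ∅`).
* (c)/(d) Row/column removal. For `x ∈ R` (resp. `y ∈ C`) cover `𝓜(R, C)` by the fibres
  `{f | f y = x}` over the `G`-neighbours `y` of `x` in `C` (resp. `x` of `y` in `R`); each fibre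
  injects into `𝓜(R − x, C − y)` by `f ↦ update f y y`; take the neighbour maximising
  `#𝓜(R − x, C − y)` (if there is no neighbour, `𝓜(R, C) = ∅`).
* (e) `#𝓜(R, C) ≤ (#C)!` when `#R = #C`, by induction on `#C` using (d) and `deg ≤ #R = #C`.
[folklore]
-/

noncomputable section
-- `Summit.ValiantsHypothesis.ValiantsHypothesis.…` is the tree's mandated layout (Sub = Summit).
set_option linter.dupNamespace false
open Finset
open scoped BigOperators

namespace Summit.ValiantsHypothesis.ValiantsHypothesis.Theorems.DivisionGap.PerMultiplesHard.MatchingCount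

variable {n : ℕ}

section Fibres

variable {G : Finset (Fin n × Fin n)} {M : Finset (Fin n) → Finset (Fin n) → Finset (Fin n → Fin n)}
  (hM : ∀ (R C : Finset (Fin n)) (f : Fin n → Fin n), f ∈ M R C ↔
    (∀ j ∈ C, f j ∈ R ∧ (f j, j) ∈ G) ∧ (∀ j, j ∉ C → f j = j) ∧
    (∀ j ∈ C, ∀ j' ∈ C, f j = f j' → j = j'))
include hM

/-- A member of `M R C` with `#R ≤ #C` maps `C` onto `R`: every row `x ∈ R` is hit by some
column `y ∈ C`. -/
theorem exists_mem_apply_eq {R C : Finset (Fin n)} {f : Fin n → Fin n} (hf : f ∈ M R C)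
    (hRC : R.card ≤ C.card) {x : Fin n} (hx : x ∈ R) : ∃ y ∈ C, f y = x := by
  rw [hM] at hf
  have hmaps : Set.MapsTo f C R := fun j hj => mem_coe.2 (hf.1 j (mem_coe.1 hj)).1
  have hinj : Set.InjOn f C := fun j hj j' hj' h => hf.2.2 j (mem_coe.1 hj) j' (mem_coe.1 hj') h
  obtain ⟨y, hy, hyx⟩ := surjOn_of_injOn_of_card_le f hmaps hinj hRC (mem_coe.2 hx)
  exact ⟨y, mem_coe.1 hy, hyx⟩

/-- **(a)** The permutations `σ` with all cells `(σ i, i)` in `G` inject, by `σ ↦ ⇑σ`, into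
`M univ univ`. -/
theorem card_perm_le :
    ((Finset.univ : Finset (Equiv.Perm (Fin n))).filter (fun σ => ∀ i, (σ i, i) ∈ G)).card ≤
      (M (Finset.univ : Finset (Fin n)) (Finset.univ : Finset (Fin n))).card := by
  refine card_le_card_of_injOn (fun σ : Equiv.Perm (Fin n) => (σ : Fin n → Fin n)) ?_ ?_
  · intro σ hσ
    have hG := (mem_filter.1 (mem_coe.1 hσ)).2
    exact mem_coe.2 ((hM _ _ _).2 ⟨fun j _ => ⟨mem_univ _, hG j⟩,
      fun j hj => absurd (mem_univ j) hj, fun j _ j' _ h => σ.injective h⟩)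
  · intro σ _ τ _ h
    exact Equiv.ext (congrFun h)

/-- For `y ∈ C` and `f ∈ M R C` with `f y = x`, the function `update f y y` (free the column `y`)
lies in `M (R.erase x) (C.erase y)`. -/
theorem update_mem {R C : Finset (Fin n)} {f : Fin n → Fin n} {x y : Fin n} (hy : y ∈ C)
    (hf : f ∈ M R C) (hfy : f y = x) : Function.update f y y ∈ M (R.erase x) (C.erase y) := by
  obtain ⟨hC, hfix, hinj⟩ := (hM _ _ _).1 hf
  refine (hM _ _ _).2 ⟨fun j hj => ?_, fun j hj => ?_, fun j hj j' hj' h => ?_⟩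
  · obtain ⟨hjy, hjC⟩ := mem_erase.1 hj
    rw [Function.update_of_ne hjy]
    exact ⟨mem_erase.2 ⟨fun h => hjy (hinj j hjC y hy (h.trans hfy.symm)), (hC j hjC).1⟩,
      (hC j hjC).2⟩
  · by_cases hjy : j = y
    · rw [hjy]
      exact Function.update_self y y f
    · rw [Function.update_of_ne hjy]
      exact hfix j fun hjC => hj (mem_erase.2 ⟨hjy, hjC⟩)
  · obtain ⟨hjy, hjC⟩ := mem_erase.1 hj
    obtain ⟨hjy', hjC'⟩ := mem_erase.1 hj'
    rw [Function.update_of_ne hjy, Function.update_of_ne hjy'] at h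
    exact hinj j hjC j' hjC' h

/-- Fibre injection for row/column removal: for `y ∈ C`, the members `f` of `M R C` with
`f y = x` inject into `M (R.erase x) (C.erase y)` by `f ↦ update f y y`. -/
theorem card_fibre_apply_le (R C : Finset (Fin n)) {y : Fin n} (hy : y ∈ C) (x : Fin n) :
    ((M R C).filter fun f => f y = x).card ≤ (M (R.erase x) (C.erase y)).card := by
  refine card_le_card_of_injOn (fun f => Function.update f y y) ?_ ?_
  · intro f hf
    obtain ⟨hf, hfy⟩ := mem_filter.1 (mem_coe.1 hf)
    exact mem_coe.2 (update_mem hM hy hf hfy)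
  · intro f hf f' hf' (h : Function.update f y y = Function.update f' y y)
    have hfy := (mem_filter.1 (mem_coe.1 hf)).2
    have hf'y := (mem_filter.1 (mem_coe.1 hf')).2
    funext j
    by_cases hjy : j = y
    · rw [hjy, hfy, hf'y]
    · have hj := congrFun h j
      rwa [Function.update_of_ne hjy, Function.update_of_ne hjy] at hj

/-- **(c)** Row removal: for `x ∈ R` and `#R = #C` there is `y ∈ C`, a `G`-neighbour of `x`
unless `M R C = ∅`, with `#(M R C) ≤ deg_C(x) · #(M (R.erase x) (C.erase y))`. -/
theorem row_removal (R C : Finset (Fin n)) (x : Fin n) (hx : x ∈ R) (hRC : R.card = C.card) :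
    ∃ y ∈ C, ((x, y) ∈ G ∨ (M R C).card = 0) ∧
      (M R C).card ≤ (C.filter fun j => (x, j) ∈ G).card * (M (R.erase x) (C.erase y)).card := by
  -- every matching lies in the fibre of the (neighbouring) column it sends to `x`
  have hcover : M R C ⊆ (C.filter fun j => (x, j) ∈ G).biUnion
      fun y => (M R C).filter fun f => f y = x := by
    intro f hf
    obtain ⟨y, hyC, hfy⟩ := exists_mem_apply_eq hM hf hRC.le hx
    have hxy : (x, y) ∈ G := by
      rw [← hfy]
      exact (((hM _ _ _).1 hf).1 y hyC).2
    exact mem_biUnion.2 ⟨y, mem_filter.2 ⟨hyC, hxy⟩, mem_filter.2 ⟨hf, hfy⟩⟩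
  by_cases hD : (C.filter fun j => (x, j) ∈ G).Nonempty
  · have hmax := exists_max_image (C.filter fun j => (x, j) ∈ G)
      (fun y => (M (R.erase x) (C.erase y)).card) hD
    obtain ⟨y, hyD, hmax⟩ := hmax
    obtain ⟨hyC, hxy⟩ := mem_filter.1 hyD
    refine ⟨y, hyC, Or.inl hxy, (card_le_card hcover).trans ?_⟩
    exact card_biUnion_le_card_mul _ _ _ fun y' hy' =>
      (card_fibre_apply_le hM R C (mem_filter.1 hy').1 x).trans (hmax y' hy')
  · have hempty : (C.filter fun j => (x, j) ∈ G) = ∅ := not_nonempty_iff_eq_empty.1 hD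
    have hzero : (M R C).card = 0 := by
      rw [hempty, biUnion_empty] at hcover
      exact card_eq_zero.2 (subset_empty.1 hcover)
    have hCne : C.Nonempty := by
      rw [← card_pos, ← hRC, card_pos]
      exact ⟨x, hx⟩
    obtain ⟨y, hyC⟩ := hCne
    exact ⟨y, hyC, Or.inr hzero, hzero.trans_le (Nat.zero_le _)⟩

/-- **(d)** Column removal: for `y ∈ C` and `#R = #C` there is `x ∈ R`, a `G`-neighbour of `y`
unless `M R C = ∅`, with `#(M R C) ≤ deg_R(y) · #(M (R.erase x) (C.erase y))`. -/
theorem col_removal (R C : Finset (Fin n)) (y : Fin n) (hy : y ∈ C) (hRC : R.card = C.card) :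
    ∃ x ∈ R, ((x, y) ∈ G ∨ (M R C).card = 0) ∧
      (M R C).card ≤ (R.filter fun i => (i, y) ∈ G).card * (M (R.erase x) (C.erase y)).card := by
  -- every matching `f` lies in the fibre of the (neighbouring) row `f y`
  have hcover : M R C ⊆ (R.filter fun i => (i, y) ∈ G).biUnion
      fun x => (M R C).filter fun f => f y = x := fun f hf =>
    mem_biUnion.2 ⟨f y, mem_filter.2 (((hM _ _ _).1 hf).1 y hy), mem_filter.2 ⟨hf, rfl⟩⟩
  by_cases hD : (R.filter fun i => (i, y) ∈ G).Nonempty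
  · have hmax := exists_max_image (R.filter fun i => (i, y) ∈ G)
      (fun x => (M (R.erase x) (C.erase y)).card) hD
    obtain ⟨x, hxD, hmax⟩ := hmax
    obtain ⟨hxR, hxy⟩ := mem_filter.1 hxD
    refine ⟨x, hxR, Or.inl hxy, (card_le_card hcover).trans ?_⟩
    exact card_biUnion_le_card_mul _ _ _ fun x' hx' =>
      (card_fibre_apply_le hM R C hy x').trans (hmax x' hx')
  · have hempty : (R.filter fun i => (i, y) ∈ G) = ∅ := not_nonempty_iff_eq_empty.1 hD
    have hzero : (M R C).card = 0 := by
      rw [hempty, biUnion_empty] at hcover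
      exact card_eq_zero.2 (subset_empty.1 hcover)
    have hRne : R.Nonempty := by
      rw [← card_pos, hRC, card_pos]
      exact ⟨y, hy⟩
    obtain ⟨x, hxR⟩ := hRne
    exact ⟨x, hxR, Or.inr hzero, hzero.trans_le (Nat.zero_le _)⟩

/-- With no columns to match, `M R ∅` contains only the identity function. -/
theorem card_M_empty_le_one (R : Finset (Fin n)) : (M R ∅).card ≤ 1 := by
  refine card_le_one.2 fun f hf g hg => ?_
  funext j
  rw [((hM _ _ _).1 hf).2.1 j (notMem_empty j), ((hM _ _ _).1 hg).2.1 j (notMem_empty j)]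

/-- **(e)** `#(M R C) ≤ (#C)!` whenever `#R = #C`: induction on `#C`, removing one column at a
time with (d) (`deg_R(y) ≤ #R = #C`). -/
theorem card_M_le_factorial (R C : Finset (Fin n)) (hRC : R.card = C.card) :
    (M R C).card ≤ C.card.factorial := by
  suffices h : ∀ (k : ℕ) (R C : Finset (Fin n)), R.card = C.card → C.card = k →
      (M R C).card ≤ k.factorial from h C.card R C hRC rfl
  intro k
  induction k with
  | zero =>
    intro R C _ hk
    rw [card_eq_zero] at hk
    subst hk
    exact (card_M_empty_le_one hM R).trans (le_of_eq Nat.factorial_zero.symm)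
  | succ k ih =>
    intro R C hRC hk
    obtain ⟨y, hy⟩ : C.Nonempty := card_pos.1 (by omega)
    obtain ⟨x, hxR, -, hle⟩ := col_removal hM R C y hy hRC
    have hRx : (R.erase x).card = (C.erase y).card := by
      rw [card_erase_of_mem hxR, card_erase_of_mem hy, hRC]
    have hCy : (C.erase y).card = k := by
      rw [card_erase_of_mem hy, hk, Nat.add_sub_cancel]
    refine hle.trans ?_
    rw [Nat.factorial_succ]
    exact Nat.mul_le_mul ((card_filter_le _ _).trans (hRC.trans hk).le)
      (ih (R.erase x) (C.erase y) hRx hCy)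

/-- For `f ∈ M R C` with `U ⊆ R` and `#R ≤ #C`, the set `S_f = {j ∈ C | f j ∈ U}` of columns
sent into `U` is a `#U`-subset of the `G`-neighbourhood of `U` in `C`. -/
theorem filter_mem_powersetCard {R C U : Finset (Fin n)} {f : Fin n → Fin n} (hf : f ∈ M R C)
    (hU : U ⊆ R) (hRC : R.card ≤ C.card) :
    (C.filter fun j => f j ∈ U) ∈
      (C.filter fun j => ∃ r ∈ U, (r, j) ∈ G).powersetCard U.card := by
  rw [mem_powersetCard]
  have hf' := (hM _ _ _).1 hf
  refine ⟨fun j hj => ?_, ?_⟩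
  · obtain ⟨hjC, hjU⟩ := mem_filter.1 hj
    exact mem_filter.2 ⟨hjC, f j, hjU, (hf'.1 j hjC).2⟩
  · -- `S_f.image f = U` and `f` is injective on `S_f ⊆ C`
    have himage : (C.filter fun j => f j ∈ U).image f = U := by
      ext r
      simp only [mem_image, mem_filter]
      constructor
      · rintro ⟨j, ⟨-, hjU⟩, rfl⟩
        exact hjU
      · intro hr
        obtain ⟨j, hjC, hj⟩ := exists_mem_apply_eq hM hf hRC (hU hr)
        refine ⟨j, ⟨hjC, ?_⟩, hj⟩
        rw [hj]
        exact hr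
    have hinjS : Set.InjOn f (C.filter fun j => f j ∈ U) := fun j hj j' hj' h =>
      hf'.2.2 j (mem_filter.1 (mem_coe.1 hj)).1 j' (mem_filter.1 (mem_coe.1 hj')).1 h
    rw [← card_image_of_injOn hinjS, himage]

/-- Left restriction: for `f ∈ M R C` with `S_f = S`, the function agreeing with `f` on `S` and
the identity elsewhere lies in `M U S`. -/
theorem restrict_left_mem {R C U S : Finset (Fin n)} {f : Fin n → Fin n} (hf : f ∈ M R C)
    (hS : (C.filter fun j => f j ∈ U) = S) : (fun j => if j ∈ S then f j else j) ∈ M U S := by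
  obtain ⟨hC, -, hinj⟩ := (hM _ _ _).1 hf
  have hSC : ∀ j ∈ S, j ∈ C ∧ f j ∈ U := fun j hj => by
    rw [← hS] at hj
    exact mem_filter.1 hj
  refine (hM _ _ _).2 ⟨fun j hj => ?_, fun j hj => if_neg hj, fun j hj j' hj' h => ?_⟩
  · rw [if_pos hj]
    exact ⟨(hSC j hj).2, (hC j (hSC j hj).1).2⟩
  · rw [if_pos hj, if_pos hj'] at h
    exact hinj j (hSC j hj).1 j' (hSC j' hj').1 h

/-- Right restriction: for `f ∈ M R C` with `S_f = S`, the function agreeing with `f` on `C \ S`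
and the identity elsewhere lies in `M (R \ U) (C \ S)`. -/
theorem restrict_right_mem {R C U S : Finset (Fin n)} {f : Fin n → Fin n} (hf : f ∈ M R C)
    (hS : (C.filter fun j => f j ∈ U) = S) :
    (fun j => if j ∈ C \ S then f j else j) ∈ M (R \ U) (C \ S) := by
  obtain ⟨hC, -, hinj⟩ := (hM _ _ _).1 hf
  refine (hM _ _ _).2 ⟨fun j hj => ?_, fun j hj => if_neg hj, fun j hj j' hj' h => ?_⟩
  · rw [if_pos hj]
    obtain ⟨hjC, hjS⟩ := mem_sdiff.1 hj
    refine ⟨mem_sdiff.2 ⟨(hC j hjC).1, fun hjU => hjS ?_⟩, (hC j hjC).2⟩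
    rw [← hS]
    exact mem_filter.2 ⟨hjC, hjU⟩
  · rw [if_pos hj, if_pos hj'] at h
    exact hinj j (mem_sdiff.1 hj).1 j' (mem_sdiff.1 hj').1 h

/-- Fibre injection for the row split: the members `f` of `M R C` with `S_f = S` inject into
`M U S ×ˢ M (R \ U) (C \ S)` by `f ↦ (f|S, f|(C \ S))`. -/
theorem card_fibre_filter_le (R C U S : Finset (Fin n)) :
    ((M R C).filter fun f => (C.filter fun j => f j ∈ U) = S).card ≤
      (M U S).card * (M (R \ U) (C \ S)).card := by
  rw [← card_product]
  refine card_le_card_of_injOn (fun f => ((fun j => if j ∈ S then f j else j),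
    (fun j => if j ∈ C \ S then f j else j))) ?_ ?_
  · intro f hf
    obtain ⟨hf, hS⟩ := mem_filter.1 (mem_coe.1 hf)
    exact mem_coe.2 (mem_product.2 ⟨restrict_left_mem hM hf hS, restrict_right_mem hM hf hS⟩)
  · intro f hf f' hf' h
    obtain ⟨hf, hS⟩ := mem_filter.1 (mem_coe.1 hf)
    obtain ⟨hf', -⟩ := mem_filter.1 (mem_coe.1 hf')
    simp only [Prod.mk.injEq] at h
    obtain ⟨h1, h2⟩ := h
    funext j
    by_cases hjS : j ∈ S
    · have hj := congrFun h1 j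
      rwa [if_pos hjS, if_pos hjS] at hj
    · by_cases hjC : j ∈ C
      · have hjCS : j ∈ C \ S := mem_sdiff.2 ⟨hjC, hjS⟩
        have hj := congrFun h2 j
        rwa [if_pos hjCS, if_pos hjCS] at hj
      · rw [((hM _ _ _).1 hf).2.1 j hjC, ((hM _ _ _).1 hf').2.1 j hjC]

/-- **(b)** Row split: for `U ⊆ R` and `#R = #C` there is `S ⊆ C` with `#S = #U` and
`#(M R C) ≤ C(#N(U), #U) · (#(M U S) · #(M (R \ U) (C \ S)))`, where
`N(U) = {j ∈ C | ∃ r ∈ U, (r, j) ∈ G}`. -/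
theorem row_split (R C U : Finset (Fin n)) (hU : U ⊆ R) (hRC : R.card = C.card) :
    ∃ S ⊆ C, S.card = U.card ∧ (M R C).card ≤
      (C.filter fun j => ∃ r ∈ U, (r, j) ∈ G).card.choose U.card *
        ((M U S).card * (M (R \ U) (C \ S)).card) := by
  have hNUC : (C.filter fun j => ∃ r ∈ U, (r, j) ∈ G) ⊆ C := filter_subset _ _
  -- every matching lies in the fibre of its `S_f`, a `#U`-subset of `N(U)`
  have hcover : M R C ⊆
      ((C.filter fun j => ∃ r ∈ U, (r, j) ∈ G).powersetCard U.card).biUnion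
        fun S => (M R C).filter fun f => (C.filter fun j => f j ∈ U) = S := fun f hf =>
    mem_biUnion.2 ⟨_, filter_mem_powersetCard hM hf hU hRC.le, mem_filter.2 ⟨hf, rfl⟩⟩
  by_cases hD : ((C.filter fun j => ∃ r ∈ U, (r, j) ∈ G).powersetCard U.card).Nonempty
  · have hmax :=
      exists_max_image ((C.filter fun j => ∃ r ∈ U, (r, j) ∈ G).powersetCard U.card)
        (fun S => (M U S).card * (M (R \ U) (C \ S)).card) hD
    obtain ⟨S, hSD, hmax⟩ := hmax
    obtain ⟨hSNU, hScard⟩ := mem_powersetCard.1 hSD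
    refine ⟨S, hSNU.trans hNUC, hScard, (card_le_card hcover).trans ?_⟩
    rw [← card_powersetCard U.card (C.filter fun j => ∃ r ∈ U, (r, j) ∈ G)]
    exact card_biUnion_le_card_mul _ _ _ fun S' hS' =>
      (card_fibre_filter_le hM R C U S').trans (hmax S' hS')
  · have hempty : (C.filter fun j => ∃ r ∈ U, (r, j) ∈ G).powersetCard U.card = ∅ :=
      not_nonempty_iff_eq_empty.1 hD
    have hzero : (M R C).card = 0 := by
      rw [hempty, biUnion_empty] at hcover
      exact card_eq_zero.2 (subset_empty.1 hcover)
    obtain ⟨S, hSC, hScard⟩ : ∃ S ⊆ C, S.card = U.card :=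
      exists_subset_card_eq ((card_le_card hU).trans hRC.le)
    exact ⟨S, hSC, hScard, hzero.trans_le (Nat.zero_le _)⟩

end Fibres

/-- Membership in the written-out partial-matching finset (the instance of `hM` used below). -/
theorem mem_matchings_iff (G : Finset (Fin n × Fin n)) (R C : Finset (Fin n))
    (f : Fin n → Fin n) :
    f ∈ ((Finset.univ : Finset (Fin n → Fin n)).filter fun f =>
      (∀ j ∈ C, f j ∈ R ∧ (f j, j) ∈ G) ∧ (∀ j, j ∉ C → f j = j) ∧
      (∀ j ∈ C, ∀ j' ∈ C, f j = f j' → j = j')) ↔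
    (∀ j ∈ C, f j ∈ R ∧ (f j, j) ∈ G) ∧ (∀ j, j ∉ C → f j = j) ∧
      (∀ j ∈ C, ∀ j' ∈ C, f j = f j' → j = j') := by
  rw [mem_filter, and_iff_right (mem_univ f)]

/-- **`stub_matchingCount`** — fibre inequalities for the number of partial matchings
`𝓜(R, C)` (functions `Fin n → Fin n` mapping `C` injectively into `R` along cells of `G` and
fixing every column outside `C`):
(a) `#{σ : Perm (Fin n) | ∀ i, (σ i, i) ∈ G} ≤ #𝓜(univ, univ)` (`σ ↦ ⇑σ` is injective);
(b) for `U ⊆ R`, `#R = #C` some `S ⊆ C` with `#S = #U` has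
`#𝓜(R, C) ≤ C(#N(U), #U) · (#𝓜(U, S) · #𝓜(R \ U, C \ S))` (fibres of `f ↦ {j ∈ C | f j ∈ U}`,
each injecting into a product by restriction);
(c)/(d) removing a row `x ∈ R` / a column `y ∈ C` costs at most a factor `deg x` / `deg y`
(fibres of `f ↦ f⁻¹ x` / `f ↦ f y`, each injecting into `𝓜(R − x, C − y)` by `f ↦ update f y y`);
(e) `#𝓜(R, C) ≤ (#C)!` when `#R = #C` (induction on `#C` via (d)). [folklore] -/
theorem stub_matchingCount :
    (∀ (n : ℕ) (G : Finset (Fin n × Fin n)),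
      ((Finset.univ : Finset (Equiv.Perm (Fin n))).filter (fun σ => ∀ i, (σ i, i) ∈ G)).card ≤
        ((Finset.univ : Finset (Fin n → Fin n)).filter fun f =>
          (∀ j ∈ (Finset.univ : Finset (Fin n)), f j ∈ (Finset.univ : Finset (Fin n)) ∧ (f j, j) ∈ G) ∧
          (∀ j, j ∉ (Finset.univ : Finset (Fin n)) → f j = j) ∧
          (∀ j ∈ (Finset.univ : Finset (Fin n)), ∀ j' ∈ (Finset.univ : Finset (Fin n)), f j = f j' → j = j')).card) ∧
    (∀ (n : ℕ) (G : Finset (Fin n × Fin n)) (R C U : Finset (Fin n)), U ⊆ R → R.card = C.card →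
      ∃ S ⊆ C, S.card = U.card ∧
        ((Finset.univ : Finset (Fin n → Fin n)).filter fun f =>
          (∀ j ∈ C, f j ∈ R ∧ (f j, j) ∈ G) ∧ (∀ j, j ∉ C → f j = j) ∧
          (∀ j ∈ C, ∀ j' ∈ C, f j = f j' → j = j')).card ≤
        (C.filter fun j => ∃ r ∈ U, (r, j) ∈ G).card.choose U.card *
          (((Finset.univ : Finset (Fin n → Fin n)).filter fun f =>
              (∀ j ∈ S, f j ∈ U ∧ (f j, j) ∈ G) ∧ (∀ j, j ∉ S → f j = j) ∧
              (∀ j ∈ S, ∀ j' ∈ S, f j = f j' → j = j')).card *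
           ((Finset.univ : Finset (Fin n → Fin n)).filter fun f =>
              (∀ j ∈ C \ S, f j ∈ R \ U ∧ (f j, j) ∈ G) ∧ (∀ j, j ∉ C \ S → f j = j) ∧
              (∀ j ∈ C \ S, ∀ j' ∈ C \ S, f j = f j' → j = j')).card)) ∧
    (∀ (n : ℕ) (G : Finset (Fin n × Fin n)) (R C : Finset (Fin n)) (x : Fin n), x ∈ R → R.card = C.card →
      ∃ y ∈ C, ((x, y) ∈ G ∨
          ((Finset.univ : Finset (Fin n → Fin n)).filter fun f =>
            (∀ j ∈ C, f j ∈ R ∧ (f j, j) ∈ G) ∧ (∀ j, j ∉ C → f j = j) ∧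
            (∀ j ∈ C, ∀ j' ∈ C, f j = f j' → j = j')).card = 0) ∧
        ((Finset.univ : Finset (Fin n → Fin n)).filter fun f =>
          (∀ j ∈ C, f j ∈ R ∧ (f j, j) ∈ G) ∧ (∀ j, j ∉ C → f j = j) ∧
          (∀ j ∈ C, ∀ j' ∈ C, f j = f j' → j = j')).card ≤
        (C.filter fun j => (x, j) ∈ G).card *
          ((Finset.univ : Finset (Fin n → Fin n)).filter fun f =>
            (∀ j ∈ C.erase y, f j ∈ R.erase x ∧ (f j, j) ∈ G) ∧ (∀ j, j ∉ C.erase y → f j = j) ∧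
            (∀ j ∈ C.erase y, ∀ j' ∈ C.erase y, f j = f j' → j = j')).card) ∧
    (∀ (n : ℕ) (G : Finset (Fin n × Fin n)) (R C : Finset (Fin n)) (y : Fin n), y ∈ C → R.card = C.card →
      ∃ x ∈ R, ((x, y) ∈ G ∨
          ((Finset.univ : Finset (Fin n → Fin n)).filter fun f =>
            (∀ j ∈ C, f j ∈ R ∧ (f j, j) ∈ G) ∧ (∀ j, j ∉ C → f j = j) ∧
            (∀ j ∈ C, ∀ j' ∈ C, f j = f j' → j = j')).card = 0) ∧
        ((Finset.univ : Finset (Fin n → Fin n)).filter fun f =>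
          (∀ j ∈ C, f j ∈ R ∧ (f j, j) ∈ G) ∧ (∀ j, j ∉ C → f j = j) ∧
          (∀ j ∈ C, ∀ j' ∈ C, f j = f j' → j = j')).card ≤
        (R.filter fun i => (i, y) ∈ G).card *
          ((Finset.univ : Finset (Fin n → Fin n)).filter fun f =>
            (∀ j ∈ C.erase y, f j ∈ R.erase x ∧ (f j, j) ∈ G) ∧ (∀ j, j ∉ C.erase y → f j = j) ∧
            (∀ j ∈ C.erase y, ∀ j' ∈ C.erase y, f j = f j' → j = j')).card) ∧
    (∀ (n : ℕ) (G : Finset (Fin n × Fin n)) (R C : Finset (Fin n)), R.card = C.card →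
      ((Finset.univ : Finset (Fin n → Fin n)).filter fun f =>
          (∀ j ∈ C, f j ∈ R ∧ (f j, j) ∈ G) ∧ (∀ j, j ∉ C → f j = j) ∧
          (∀ j ∈ C, ∀ j' ∈ C, f j = f j' → j = j')).card ≤ C.card.factorial) :=
  ⟨fun _ G => card_perm_le (mem_matchings_iff G),
    fun _ G R C U => row_split (mem_matchings_iff G) R C U,
    fun _ G R C x => row_removal (mem_matchings_iff G) R C x,
    fun _ G R C y => col_removal (mem_matchings_iff G) R C y,
    fun _ G R C => card_M_le_factorial (mem_matchings_iff G) R C⟩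

end Summit.ValiantsHypothesis.ValiantsHypothesis.Theorems.DivisionGap.PerMultiplesHard.MatchingCount
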